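import Literature.MathematicalPhysics.QuantumFieldTheory.Balaban1983to89.B12Eq311CurrentExpansion
import Literature.MathematicalPhysics.QuantumFieldTheory.Balaban1983to89.B9Eq373V3Analytic

/-!
# `Balaban1983to89.B12Eq44Analytic` — T. Bałaban, *Renormalization group approach to lattice gauge field theories. I*,
Commun. Math. Phys. **109** (1987) 249–301 [Balaban1987RG1], p. 281 (4.4): **«we have the function E^{(j)}(X, exp iξ𝐀), i.e. the
function with 𝐔 = 1, 𝐉 = 0. Thus it is defined and analytic on the space of configurations 𝐀 satisfying max{|𝐀|_X, |P₁(□₀)𝐀|_X,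
|∇^ξ𝐀|_X, |Δ^ξ𝐀|_X} < α₂. (4.4)» — PART 1, «analytic»: THE SUBSTITUTION `𝐀 ↦ (exp iξ𝐀, J(exp iξ𝐀))` ((1.9), (3.10) at `𝐔 = 1`) IS
COMPLEX-ANALYTIC on the field space of the finite torus, hence `𝐀 ↦ E(exp iξ𝐀, J(exp iξ𝐀))` is analytic wherever `E` is analytic at
the substituted pair** — the composition step of the printed inference («It is obtained from the analytic function E^{(j)}(X, 𝐔′, 𝐉′)
by the substitution …», p. 272).  PART 2 = the sibling `B12Eq44Space` («defined»: membership of the pair in the concrete space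
`U^c_j(X, α₀, α₁)` of `B12RegularSpaces111` for `𝐀` in the (4.4)-set, and the printed sentence assembled).

HONEST FRAMING (cell `lit-balaban`, verbatim): statement-level skeleton of published theorems with citation tags; proofs where landed; nothing here is a claim about the Yang–Mills mass gap.

PDF held: `paper:balaban1987-cmp109-rg-i-small-field` (journal page = PDF page + 248); pp. 261–263 [PDF 13–15], 272 [PDF 24], 281
[PDF 33] re-read by this unit from the text layer (`lit read … --pages 14-16,24-25,33-35`).

WHAT IS REPRODUCED.  SKELETON row `B12.Eq4.4` ((4.4) p. 281; owner cells r09/r20; until now «typed-existing (schematic sup-norm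
domination)», `B12Decay510FromB11.NormDominated`), the «analytic» half, on the carriers OF RECORD — `Setup` bond configurations,
the substitution (3.10) `B12Eq311CurrentExpansion.sub310`, the current (1.8)/(1.9) `B12Eq18Current.current`/`ofBackground`, the
concrete spaces `B12RegularSpaces111.space′`, and the analytic-family calculus `B9Eq373V3Analytic` (`CfgAnalyticAt`, `analyticAt_divP`,
`analyticAt_imC`, `analyticAt_plaqU_val`, `cfgAnalyticAt_prodCfg`) — all BY NAME; nothing re-declared, no definition.

THE PRINT, verbatim.  p. 281 [33]: *«In the last formula above we have the function E^{(j)}(X, exp iξ𝐀), i.e. the function with 𝐔 = 1,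
𝐉 = 0. Thus it is defined and analytic on the space of configurations 𝐀 satisfying max{|𝐀|_X, |P₁(□₀)𝐀|_X, |∇^ξ𝐀|_X, |Δ^ξ𝐀|_X} < α₂.
(4.4)»*  p. 272 [24]: *«It is obtained from the analytic function E^{(j)}(X, 𝐔′, 𝐉′) by the substitution 𝐔′ = exp iξ𝐀U_{k+1},
𝐉′ = D^{ξ*}_{exp iξ𝐀U_{k+1}} ξ⁻²π Im ∂ exp iξ𝐀U_{k+1}. (3.10)»*  p. 261 [13]: *«J_j = D^{ξ*}_{U_j} ξ⁻²π Im ∂U_j, (1.8) … we replace the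
functions E^{(j)}(X, g, U_j) by new functions E^{(j)}(X, g, 𝐔, 𝐉) with the second variable replacing the functions (1.8), thus
E^{(j)}(X, g, U_j) = E^{(j)}(X, g, U_j, J_j). (1.9)»*  p. 263 [15]: *«We assume that the function E^{(j)}(X, g_{j−1}, 𝐔, 𝐉) is defined and
analytic on the space U^c_j(X, α₀, α₁)»*.

THE READING (located).  (a) `E^{(j)}(X, exp iξ𝐀)` is, by (1.9), the two-slot function at the pair `(exp iξ𝐀, J(exp iξ𝐀))` =
`ofBackground π ξ (sub310 ξ 𝐀 1)` — (3.10) with `𝐔 = 1` (`sub310_one_apply`: `sub310 ξ 𝐀 1 = exp iξ𝐀` bondwise).  (b) «analytic» in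
`(𝐔, 𝐉)` is read on the ambient complex-linear carrier `(bonds → 𝔸) × (bonds → 𝔸)` of the pairs (the unit-valued `𝐔` through its values
in `𝔸`) as Mathlib `AnalyticAt ℂ`; the p. 263 sentence is a HYPOTHESIS on `E` (the inductive assumption; `Step.SFHyp` does not type it,
DIVERGENCE D-f2.1).  (c) `𝔸` is any complete normed `ℂ`-algebra (the matrix algebras of the models); `π` is the printed projection onto
`𝔤ᶜ`, here any `ℂ`-linear map with an operator-norm bound `‖πX‖ ≤ Cπ‖X‖` (continuity is all that analyticity needs).

WHAT IS PROVED (theorems only; 0 sorry, 0 new facts, axioms standard).  `sub310_one_apply`/`sub310_one_eq`; **`analyticAt_current`** —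
the current (1.8) `e ↦ J(𝒱(e))(b)` is analytic along ANY analytic family of configurations `𝒱` over any complex normed parameter space
(plaquette variables, inverses, transports, the finite sum `D*`); `analyticAt_apply_bond`; **`cfgAnalyticAt_sub310`** (`𝐀 ↦ exp iξ𝐀U`
is an analytic family, every `U`: the exponential is entire); **`analyticAt_pair_sub310`** (`𝐀 ↦ (exp iξ𝐀U, J(exp iξ𝐀U))` is analytic at
every `𝐀`); **`analyticAt_E_sub310_of_analyticAt`** (pure composition, every `U` — the substitution (3.10) of (3.13)) and
**`analyticAt_E_sub310_one_of_mem`** (`U = 1`: composition with the p. 263 hypothesis at a point whose substituted pair lies in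
`U^c_j(X, α₀, α₁)`).  NOT here: the «defined» half and the (4.4)-set (sibling
`B12Eq44Space`); the general `(𝐔, 𝐉)` of (3.13)/(3.14).  Unit `lit-balaban-p05` (Phase-2 seat p05 gen 7; free-target protocol
G.5-34(d); TAKING line HOME/STATUS.md 2026-08-21T18:39:05Z; owners r09/r20, referee ref-5), HOME `run/shared/lean/pub/lit-balaban/`.
-/

open NormedSpace Complex

namespace Literature.MathematicalPhysics.QuantumFieldTheory.Balaban1983to89.B12Eq44Analytic

open Literature.MathematicalPhysics.QuantumFieldTheory.Balaban1983to89
open Literature.MathematicalPhysics.QuantumFieldTheory.Balaban1983to89.B9Eq37Insertion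
open Literature.MathematicalPhysics.QuantumFieldTheory.Balaban1983to89.B9Eq39Adjoint
open Literature.MathematicalPhysics.QuantumFieldTheory.Balaban1983to89.B9TorusCalculus
open Literature.MathematicalPhysics.QuantumFieldTheory.Balaban1983to89.B12RegularSpaces111
open Literature.MathematicalPhysics.QuantumFieldTheory.Balaban1983to89.B12Eq18Current
open Literature.MathematicalPhysics.QuantumFieldTheory.Balaban1983to89.B12Eq311CurrentExpansion
open Literature.MathematicalPhysics.QuantumFieldTheory.Balaban1983to89.B9Eq373V3Analytic

noncomputable section

variable {P : Params} {i : ℕ} {𝔸 : Type*} [NormedRing 𝔸] [NormedAlgebra ℂ 𝔸] [CompleteSpace 𝔸]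

/-! ## §1. (3.10) at `𝐔 = 1`: the configuration `exp iξ𝐀` of (4.4) -/

/-- (3.10) at `𝐔 = 1`: `sub310 ξ 𝐀 1 (b) = exp iξ𝐀(b)` — the configuration `exp iξ𝐀` of (4.4) IS the substituted configuration of
(3.13) «with 𝐔 = 1». [cite: Balaban1987RG1, (3.10) p.272] -/
theorem sub310_one_apply (ξ : ℝ) (A : PBond P i → 𝔸) (b : PBond P i) :
    sub310 ξ A (1 : PBond P i → 𝔸ˣ) b = expI ξ (A b) := by
  rw [sub310_eq_expI_mul, Pi.one_apply, mul_one]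

/-- `sub310 ξ 𝐀 1 = exp iξ𝐀` as configurations. [cite: Balaban1987RG1, (3.10) p.272] -/
theorem sub310_one_eq (ξ : ℝ) (A : PBond P i → 𝔸) :
    sub310 ξ A (1 : PBond P i → 𝔸ˣ) = fun b => expI ξ (A b) :=
  funext (sub310_one_apply ξ A)


/-! ## §2. «analytic»: the substitution `𝐀 ↦ (exp iξ𝐀, J(exp iξ𝐀))` is analytic; composition with the p. 263 hypothesis -/

section Analytic

variable {E : Type*} [NormedAddCommGroup E] [NormedSpace ℂ E]

omit [CompleteSpace 𝔸] in
/-- A `ℂ`-linear `π` with an operator-norm bound is analytic after any analytic map. [folklore] -/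
private theorem analyticAt_pi_comp {π : 𝔸 →ₗ[ℂ] 𝔸} {Cπ : ℝ} (hπn : ∀ X, ‖π X‖ ≤ Cπ * ‖X‖) {X : E → 𝔸} {e₀ : E}
    (hX : AnalyticAt ℂ X e₀) : AnalyticAt ℂ (fun e => π (X e)) e₀ := by
  have h := ((π.mkContinuous Cπ hπn).analyticAt (X e₀)).comp hX
  simpa only [Function.comp_def, LinearMap.mkContinuous_apply] using h

/-- **The current (1.8) along an analytic family is analytic**: for a family of configurations `𝒱 : E → (bonds → 𝔸ˣ)` over a complex
normed space `E` with every bond variable `e ↦ 𝒱(e)(b′)` analytic at `e₀` (`B9Eq373V3Analytic.CfgAnalyticAt`), and `π` with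
`‖πX‖ ≤ Cπ‖X‖`, the map `e ↦ J(𝒱(e))(b) = (D^{ξ*}_{𝒱(e)} ξ⁻²π Im ∂𝒱(e))(b)` is analytic at `e₀` (plaquette variables, their inverses,
transports and the finite sum `D*` — `analyticAt_plaqU_val`, `analyticAt_imC`, `analyticAt_divP`). [cite: Balaban1987RG1, (1.8) p.261] -/
theorem analyticAt_current {π : 𝔸 →ₗ[ℂ] 𝔸} {Cπ : ℝ} (hπn : ∀ X, ‖π X‖ ≤ Cπ * ‖X‖) (ξ : ℝ)
    {𝒱 : E → PBond P i → 𝔸ˣ} {e₀ : E} (h : CfgAnalyticAt (fun e => dirForm (𝒱 e)) e₀) (b : PBond P i) :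
    AnalyticAt ℂ (fun e => current π ξ (𝒱 e) b) e₀ := by
  simp only [current_apply]
  refine analyticAt_csmul _ (analyticAt_divP h (F := fun e => imPlaq π ξ (𝒱 e)) (fun κ ν y => ?_) b.dir b.src)
  simp only [imPlaq]
  exact analyticAt_csmul _ (analyticAt_pi_comp hπn (analyticAt_imC (analyticAt_plaqU_val h κ ν y)))

omit [CompleteSpace 𝔸] in
/-- On the finite torus every letter `𝐀 ↦ 𝐀(b)` is a continuous linear functional of the field space, hence analytic. [folklore] -/
private theorem analyticAt_apply_bond (b : PBond P i) (A₀ : PBond P i → 𝔸) :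
    AnalyticAt ℂ (fun A : PBond P i → 𝔸 => A b) A₀ :=
  (ContinuousLinearMap.proj (R := ℂ) (φ := fun _ : PBond P i => 𝔸) b).analyticAt A₀

/-- **`𝐀 ↦ exp iξ𝐀·U` is an analytic family** on the field space of the finite torus, for every configuration `U` (the substitution
(3.10) «𝐔′ = exp iξ𝐀U_{k+1} … more generally, for any regular configuration U»; `B9Eq373V3Analytic.cfgAnalyticAt_prodCfg`: the exponential
is entire). [cite: Balaban1987RG1, (3.10) p.272] -/
theorem cfgAnalyticAt_sub310 (ξ : ℝ) (U : PBond P i → 𝔸ˣ) (A₀ : PBond P i → 𝔸) :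
    CfgAnalyticAt (fun A : PBond P i → 𝔸 => dirForm (sub310 ξ A U)) A₀ := by
  simp only [dirForm_sub310]
  exact cfgAnalyticAt_prodCfg (dirForm U) ξ (𝒜 := fun A => dirForm A) (fun κ z => analyticAt_apply_bond ⟨z, κ⟩ A₀)

/-- **The substitution `𝐀 ↦ (exp iξ𝐀U, J(exp iξ𝐀U))` of (3.10) is analytic** into the ambient carrier `(bonds → 𝔸) × (bonds → 𝔸)` of
the pairs (bond values of the units, and the current (1.8)), at every `𝐀`, for every `U`. [cite: Balaban1987RG1, (3.10) p.272 with (1.9) p.261] -/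
theorem analyticAt_pair_sub310 {π : 𝔸 →ₗ[ℂ] 𝔸} {Cπ : ℝ} (hπn : ∀ X, ‖π X‖ ≤ Cπ * ‖X‖) (ξ : ℝ) (U : PBond P i → 𝔸ˣ)
    (A₀ : PBond P i → 𝔸) :
    AnalyticAt ℂ (fun A : PBond P i → 𝔸 =>
      ((fun b => ((ofBackground π ξ (sub310 ξ A U)).U b : 𝔸)), (ofBackground π ξ (sub310 ξ A U)).J)) A₀ := by
  refine AnalyticAt.prod ?_ ?_
  · exact AnalyticAt.pi fun b => (cfgAnalyticAt_sub310 ξ U A₀) b.dir b.src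
  · exact AnalyticAt.pi fun b => analyticAt_current hπn ξ (cfgAnalyticAt_sub310 ξ U A₀) b

variable {V : Type*} [NormedAddCommGroup V] [NormedSpace ℂ V]

/-- **Pure composition** («It is obtained from the analytic function E^{(j)}(X, 𝐔′, 𝐉′) by the substitution (3.10)»): if `E` is analytic
at the (image of the) substituted pair of `𝐀₀`, then `𝐀 ↦ E(exp iξ𝐀U, J(exp iξ𝐀U))` is analytic at `𝐀₀`.
[cite: Balaban1987RG1, (3.10) p.272 with (4.4) p.281] -/
theorem analyticAt_E_sub310_of_analyticAt {π : 𝔸 →ₗ[ℂ] 𝔸} {Cπ : ℝ} (hπn : ∀ X, ‖π X‖ ≤ Cπ * ‖X‖) (ξ : ℝ)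
    (U : PBond P i → 𝔸ˣ) (E : (PBond P i → 𝔸) × (PBond P i → 𝔸) → V) (A₀ : PBond P i → 𝔸)
    (hE : AnalyticAt ℂ E ((fun b => ((ofBackground π ξ (sub310 ξ A₀ U)).U b : 𝔸)), (ofBackground π ξ (sub310 ξ A₀ U)).J)) :
    AnalyticAt ℂ (fun A : PBond P i → 𝔸 =>
      E ((fun b => ((ofBackground π ξ (sub310 ξ A U)).U b : 𝔸)), (ofBackground π ξ (sub310 ξ A U)).J)) A₀ :=
  hE.fun_comp_of_eq (analyticAt_pair_sub310 hπn ξ U A₀) rfl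

/-- **Composition with the p. 263 hypothesis**: if `E` is analytic at every point of `U^c_j(X, α₀, α₁)` (READING (b)) and the substituted
pair of `𝐀₀` lies in the space, then `𝐀 ↦ E(exp iξ𝐀, J(exp iξ𝐀))` is analytic at `𝐀₀`. [cite: Balaban1987RG1, (4.4) p.281 with p.263] -/
theorem analyticAt_E_sub310_one_of_mem (𝓜 : Model 𝔸) {F : Frame P i 𝔸} {c : StepConsts} {α₀ α₁ : ℝ}
    {π : 𝔸 →ₗ[ℂ] 𝔸} {Cπ : ℝ} (hπn : ∀ X, ‖π X‖ ≤ Cπ * ‖X‖)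
    (E : (PBond P i → 𝔸) × (PBond P i → 𝔸) → V)
    (hE : ∀ Φ ∈ space' 𝓜 F c α₀ α₁, AnalyticAt ℂ E ((fun b => (Φ.U b : 𝔸)), Φ.J))
    (A₀ : PBond P i → 𝔸) (hmem : ofBackground π c.ξ (sub310 c.ξ A₀ (1 : PBond P i → 𝔸ˣ)) ∈ space' 𝓜 F c α₀ α₁) :
    AnalyticAt ℂ (fun A : PBond P i → 𝔸 =>
      E ((fun b => ((ofBackground π c.ξ (sub310 c.ξ A (1 : PBond P i → 𝔸ˣ))).U b : 𝔸)),
        (ofBackground π c.ξ (sub310 c.ξ A (1 : PBond P i → 𝔸ˣ))).J)) A₀ :=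
  analyticAt_E_sub310_of_analyticAt hπn c.ξ 1 E A₀ (hE _ hmem)

end Analytic

end

end Literature.MathematicalPhysics.QuantumFieldTheory.Balaban1983to89.B12Eq44Analytic
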